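import Mathlib.MeasureTheory.Group.Prod
import Literature.Analysis.FluidPDE.TaoAveragedSobolev
import HarnessLib

/-!
# Tao's averaged Navier–Stokes setting: the cancellation law (1.2) for the Euler form, proved

T. Tao, *Finite time blowup for an averaged three-dimensional Navier–Stokes equation*,
J. Amer. Math. Soc. **29** (2016), 601–674 = arXiv:1402.0290v3 (held as `paper:arxiv-1402.0290`;
all numbers are those of that text): §1.1, p. 3, equations (1.2)–(1.4) and the last sentence of
p. 3; p. 7, equation (1.16) and Theorem 1.5.

A sorry-free companion of `Literature/Analysis/FluidPDE/TaoAveragedSobolev.lean` (whose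
declarations `Λ`, `cdot`, `eulerForm`, `IsFourierDivFree`, `MemH10df`, `AveragingDatum`,
`AveragingDatum.form/HasCancellation/IsSymmetric/euler` are used unchanged). It proves:

* `Λ_cyclic_sum_eq_zero` — the pointwise identity behind the cancellation: the sum of Tao's
  symbol `Λ` (1.4) over the three cyclic relabellings `(1,2,3), (1,3,2), (3,2,1)` of
  divergence-free arguments on `ξ₁ + ξ₂ + ξ₃ = 0` vanishes;
* `measurePreserving_shear₂₃`, `measurePreserving_shear₁₃`,
  `integral_eq_zero_of_relabel_sum_ae_eq_zero` — the relabellings `(ξ₁,ξ₂) ↦ (ξ₁,ξ₃)`,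
  `(ξ₁,ξ₂) ↦ (ξ₃,ξ₂)` (`ξ₃ = -ξ₁-ξ₂`) preserve `μ × μ` (any right-invariant s-finite `μ` on a
  measurable abelian group), hence `∫ F d(μ × μ) = 0` whenever `F + F∘τ + F∘ρ = 0` a.e.;
* `integral_Λ_self_eq_zero` — for *any* `û : ℝ³ → ℂ³` with `ξ · û(ξ) = 0` for a.e. `ξ`, the
  Euler integral `∫∫ Λ_{ξ₁,ξ₂,ξ₃}(û(ξ₁), û(ξ₂), û(ξ₃)) dξ₁ dξ₂` (`ξ₃ = -ξ₁-ξ₂`) is `0`;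
* `eulerForm_self_eq_zero` — **Tao's cancellation law (1.2)**, `⟨B(u,u), u⟩ = 0`, for every
  `u ∈ L²(ℝ³; ℂ³)` that is divergence free on the Fourier side, in particular
  (`eulerForm_self_eq_zero_of_memH10df`) for all `u ∈ H¹⁰_df(ℝ³)` as printed;
* `AveragingDatum.euler_hasCancellation`, `AveragingDatum.euler_isSymmetric`,
  `AveragingDatum.exists_isSymmetric_and_hasCancellation` — the Euler datum (`mᵢ ≡ 1`,
  `Rᵢ = id`, `λᵢ = 1`, for which `B̃ = B`, accepted `AveragingDatum.euler_form`) is a symmetric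
  averaged Euler bilinear operator obeying the cancellation property (1.16); so the class of
  operators over which Theorem 1.5 quantifies is inhabited.

## Why `AveragingDatum.HasCancellation` itself is not a theorem

`AveragingDatum.HasCancellation 𝒜` (accepted, `TaoAveragedSobolev.lean`) is the *property* (1.16)
`⟨B̃(u,u), u⟩ = 0 ∀ u ∈ H¹⁰_df` of a given averaging datum `𝒜` — a hypothesis on the operator in
Theorem 1.5, not a claim about all averaged operators. Tao, p. 7: "Because we have not imposed
any symmetry or anti-symmetry hypotheses on the averaging measure `μ`, rotations `R_j`, and
Fourier multipliers `m_j(D)`, the analogue (1.16) of the cancellation condition (1.2) is not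
automatically satisfied." What the source does assert unconditionally is (1.2), i.e. (1.16) for
`B̃ = B`; that is what is proved here (`eulerForm_self_eq_zero`, `euler_hasCancellation`).

## Proof of (1.2)

(Tao, p. 3: the condition `û(ξᵢ) ∈ ξᵢ^⊥` "provides an alternate way to establish (1.2)".)

Write `F(ξ₁, ξ₂) = Λ_{ξ₁,ξ₂,ξ₃}(û(ξ₁), û(ξ₂), û(ξ₃))`, `ξ₃ = -ξ₁-ξ₂`. The involutions
`τ(ξ₁, ξ₂) = (ξ₁, ξ₃)` and `ρ(ξ₁, ξ₂) = (ξ₃, ξ₂)` (exchanging `ξ₂ ↔ ξ₃`, resp. `ξ₁ ↔ ξ₃`, on the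
hyperplane `ξ₁ + ξ₂ + ξ₃ = 0`) preserve Lebesgue measure on `ℝ³ × ℝ³` (they are words in the
shear `(x, y) ↦ (x + y, -x)` and the swap), so `∫ F = ∫ F ∘ τ = ∫ F ∘ ρ`; and pointwise
`F + F ∘ τ + F ∘ ρ = (û₂·û₃)(û₁·(ξ₂+ξ₃)) + (û₁·û₃)(û₂·(ξ₁+ξ₃)) + (û₁·û₂)(û₃·(ξ₁+ξ₂))`
`= -(û₂·û₃)(û₁·ξ₁) - (û₁·û₃)(û₂·ξ₂) - (û₁·û₂)(û₃·ξ₃) = 0` (`ûᵢ = û(ξᵢ)`, products complex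
bilinear). Hence `3 ∫ F = 0` when `F` is integrable; when it is not, `∫ F = 0` is the Bochner
convention built into `eulerForm` (documented there). Either way `⟨B(u,u), u⟩ = -πi ∫ F = 0`.
Only the divergence-free condition is used (no regularity, no realness), exactly as in Tao's
remark.

## References

* T. Tao, J. Amer. Math. Soc. 29 (2016), 601–674, arXiv:1402.0290v3, §1.1 ((1.2)–(1.4), p. 3;
  (1.13), (1.16), Thm. 1.5, p. 7). Key `Tao2016AveragedNS`.
-/

noncomputable section

open MeasureTheory Set Filter Complex
open scoped ENNReal

namespace Literature.Analysis.FluidPDE.Tao2016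

/-! ### The pointwise identity -/

/-- **Cyclic symmetrisation of Tao's symbol `Λ` (1.4) vanishes on divergence-free arguments**:
if `ξ₁ · X₁ = ξ₂ · X₂ = ξ₃ · X₃ = 0` with `ξ₃ = -ξ₁ - ξ₂`, then
`Λ_{ξ₁,ξ₂,ξ₃}(X₁,X₂,X₃) + Λ_{ξ₁,ξ₃,ξ₂}(X₁,X₃,X₂) + Λ_{ξ₃,ξ₂,ξ₁}(X₃,X₂,X₁) = 0`: the sum equals
`(X₂·X₃)(X₁·(ξ₂+ξ₃)) + (X₁·X₃)(X₂·(ξ₁+ξ₃)) + (X₁·X₂)(X₃·(ξ₁+ξ₂))` and `ξ₂+ξ₃ = -ξ₁`, `ξ₁+ξ₃ = -ξ₂`,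
`ξ₁+ξ₂ = -ξ₃` (the computation behind Tao's remark, p. 3, that `û(ξᵢ) ∈ ξᵢ^⊥` "provides an
alternate way to establish" the cancellation law (1.2)). [cite: Tao2016AveragedNS, §1.1 (1.2)–(1.4) p. 3] -/
theorem Λ_cyclic_sum_eq_zero {ξ₁ ξ₂ : EuclideanSpace ℝ (Fin 3)}
    {X₁ X₂ X₃ : EuclideanSpace ℂ (Fin 3)}
    (h₁ : cdot (FunctionSpaces.EuclideanSpace.complexify ξ₁) X₁ = 0)
    (h₂ : cdot (FunctionSpaces.EuclideanSpace.complexify ξ₂) X₂ = 0)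
    (h₃ : cdot (FunctionSpaces.EuclideanSpace.complexify (-ξ₁ - ξ₂)) X₃ = 0) :
    Λ ξ₁ ξ₂ X₁ X₂ X₃ + Λ ξ₁ (-ξ₁ - ξ₂) X₁ X₃ X₂ + Λ (-ξ₁ - ξ₂) ξ₂ X₃ X₂ X₁ = 0 := by
  simp only [Λ, cdot, Fin.sum_univ_three, FunctionSpaces.EuclideanSpace.complexify_apply,
    PiLp.sub_apply, PiLp.neg_apply, Complex.ofReal_neg, Complex.ofReal_sub] at h₁ h₂ h₃ ⊢
  linear_combination
    (-(X₂ 0 * X₃ 0 + X₂ 1 * X₃ 1 + X₂ 2 * X₃ 2)) * h₁ +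
    (-(X₁ 0 * X₃ 0 + X₁ 1 * X₃ 1 + X₁ 2 * X₃ 2)) * h₂ +
    (-(X₁ 0 * X₂ 0 + X₁ 1 * X₂ 1 + X₁ 2 * X₂ 2)) * h₃

/-! ### Measure-preserving relabellings of `ξ₁ + ξ₂ + ξ₃ = 0` and the averaging step -/

section Relabel

variable {G : Type*} [MeasurableSpace G] [AddCommGroup G] [MeasurableAdd₂ G] [MeasurableNeg G]
  (μ : Measure G) [SFinite μ] [μ.IsAddRightInvariant]

/-- The involution `(ξ₁, ξ₂) ↦ (ξ₁, ξ₃)`, `ξ₃ = -ξ₁ - ξ₂` (exchange `ξ₂ ↔ ξ₃` on the hyperplane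
`ξ₁ + ξ₂ + ξ₃ = 0` over which (1.3) integrates), preserves `μ × μ` for every right-invariant
s-finite measure `μ` on a measurable abelian group (it is a word in Mathlib's shear
`(x, y) ↦ (x + y, -x)`, `measurePreserving_add_prod_neg_right`, and the swap). [folklore] -/
theorem measurePreserving_shear₂₃ :
    MeasurePreserving (fun z : G × G => (z.1, -z.1 - z.2)) (μ.prod μ) (μ.prod μ) := by
  have hA := measurePreserving_add_prod_neg_right μ μ
  have hS : MeasurePreserving (Prod.swap : G × G → G × G) (μ.prod μ) (μ.prod μ) :=
    Measure.measurePreserving_swap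
  convert hA.comp (hA.comp hS) using 1
  funext z
  rcases z with ⟨x, y⟩
  simp only [Function.comp_apply, Prod.swap_prod_mk, Prod.mk.injEq]
  exact ⟨by abel, by abel⟩

/-- The involution `(ξ₁, ξ₂) ↦ (ξ₃, ξ₂)`, `ξ₃ = -ξ₁ - ξ₂` (exchange `ξ₁ ↔ ξ₃` on the hyperplane
`ξ₁ + ξ₂ + ξ₃ = 0`), preserves `μ × μ` (same hypotheses as `measurePreserving_shear₂₃`). [folklore] -/
theorem measurePreserving_shear₁₃ :
    MeasurePreserving (fun z : G × G => (-z.1 - z.2, z.2)) (μ.prod μ) (μ.prod μ) := by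
  have hA := measurePreserving_add_prod_neg_right μ μ
  have hS : MeasurePreserving (Prod.swap : G × G → G × G) (μ.prod μ) (μ.prod μ) :=
    Measure.measurePreserving_swap
  convert hS.comp (hA.comp hA) using 1
  funext z
  rcases z with ⟨x, y⟩
  simp only [Function.comp_apply, Prod.swap_prod_mk, Prod.mk.injEq]
  exact ⟨by abel, by abel⟩

variable {μ} in
/-- **The averaging step.** If `F : G × G → ℂ` satisfies
`F(ξ₁, ξ₂) + F(ξ₁, ξ₃) + F(ξ₃, ξ₂) = 0` for a.e. `(ξ₁, ξ₂)` (`ξ₃ = -ξ₁ - ξ₂`), then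
`∫ F d(μ × μ) = 0`: if `F` is integrable, the two relabellings preserve `μ × μ`
(`measurePreserving_shear₂₃/₁₃`), so `3 ∫ F = ∫ (F + F∘τ + F∘ρ) = 0`; if not, `∫ F = 0` is the
Bochner convention. [folklore] -/
theorem integral_eq_zero_of_relabel_sum_ae_eq_zero {F : G × G → ℂ}
    (hae : ∀ᵐ p ∂(μ.prod μ), F p + F (p.1, -p.1 - p.2) + F (-p.1 - p.2, p.2) = 0) :
    ∫ p, F p ∂(μ.prod μ) = 0 := by
  have hτ := measurePreserving_shear₂₃ μ
  have hρ := measurePreserving_shear₁₃ μ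
  by_cases hint : Integrable F (μ.prod μ)
  · have hτi : Integrable (fun p : G × G => F (p.1, -p.1 - p.2)) (μ.prod μ) :=
      hτ.integrable_comp_of_integrable hint
    have hρi : Integrable (fun p : G × G => F (-p.1 - p.2, p.2)) (μ.prod μ) :=
      hρ.integrable_comp_of_integrable hint
    have eτ : ∫ p : G × G, F (p.1, -p.1 - p.2) ∂(μ.prod μ) = ∫ p, F p ∂(μ.prod μ) := by
      have hsm : AEStronglyMeasurable F
          (Measure.map (fun z : G × G => (z.1, -z.1 - z.2)) (μ.prod μ)) := by
        rw [hτ.map_eq]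
        exact hint.aestronglyMeasurable
      rw [← integral_map hτ.measurable.aemeasurable hsm, hτ.map_eq]
    have eρ : ∫ p : G × G, F (-p.1 - p.2, p.2) ∂(μ.prod μ) = ∫ p, F p ∂(μ.prod μ) := by
      have hsm : AEStronglyMeasurable F
          (Measure.map (fun z : G × G => (-z.1 - z.2, z.2)) (μ.prod μ)) := by
        rw [hρ.map_eq]
        exact hint.aestronglyMeasurable
      rw [← integral_map hρ.measurable.aemeasurable hsm, hρ.map_eq]
    have h12 : Integrable (fun p : G × G => F p + F (p.1, -p.1 - p.2)) (μ.prod μ) := hint.add hτi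
    have hsum : ∫ p : G × G, (F p + F (p.1, -p.1 - p.2) + F (-p.1 - p.2, p.2)) ∂(μ.prod μ) =
        3 * ∫ p, F p ∂(μ.prod μ) := by
      rw [integral_add h12 hρi, integral_add hint hτi, eτ, eρ]
      ring
    have h0 : ∫ p : G × G, (F p + F (p.1, -p.1 - p.2) + F (-p.1 - p.2, p.2)) ∂(μ.prod μ) = 0 := by
      rw [integral_congr_ae hae, integral_zero]
    rw [h0] at hsum
    have h3ne : (3 : ℂ) ≠ 0 := by norm_num
    exact (mul_eq_zero.mp hsum.symm).resolve_left h3ne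
  · exact integral_undef hint

end Relabel

/-! ### The cancellation law (1.2) -/

/-- **The symmetrisation argument** (Tao 2016, p. 3, "alternate way to establish (1.2)"): for
any `û : ℝ³ → ℂ³` with `ξ · û(ξ) = 0` for a.e. `ξ`,
`∫∫ Λ_{ξ₁,ξ₂,ξ₃}(û(ξ₁), û(ξ₂), û(ξ₃)) dξ₁ dξ₂ = 0` (`ξ₃ = -ξ₁-ξ₂`; Bochner integral on `ℝ³ × ℝ³`):
the divergence-free condition holds at `ξ₁`, `ξ₂`, `ξ₃` for a.e. `(ξ₁, ξ₂)` (the three coordinate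
maps are quasi-measure-preserving), so the integrand satisfies the hypothesis of
`integral_eq_zero_of_relabel_sum_ae_eq_zero` by `Λ_cyclic_sum_eq_zero`. [cite: Tao2016AveragedNS, §1.1 (1.2) p. 3] -/
theorem integral_Λ_self_eq_zero {û : EuclideanSpace ℝ (Fin 3) → EuclideanSpace ℂ (Fin 3)}
    (h : ∀ᵐ ξ, cdot (FunctionSpaces.EuclideanSpace.complexify ξ) (û ξ) = 0) :
    ∫ p : EuclideanSpace ℝ (Fin 3) × EuclideanSpace ℝ (Fin 3),
      Λ p.1 p.2 (û p.1) (û p.2) (û (-p.1 - p.2)) = 0 := by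
  rw [Measure.volume_eq_prod]
  refine integral_eq_zero_of_relabel_sum_ae_eq_zero ?_
  filter_upwards [(Measure.quasiMeasurePreserving_fst (μ := volume) (ν := volume)).ae h,
    (Measure.quasiMeasurePreserving_snd (μ := volume) (ν := volume)).ae h,
    ((Measure.quasiMeasurePreserving_snd (μ := volume) (ν := volume)).comp
      (measurePreserving_shear₂₃
        (volume : Measure (EuclideanSpace ℝ (Fin 3)))).quasiMeasurePreserving).ae h]
    with p e1 e2 e3
  obtain ⟨ξ₁, ξ₂⟩ := p
  have k1 : -ξ₁ - (-ξ₁ - ξ₂) = ξ₂ := by abel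
  have k2 : -(-ξ₁ - ξ₂) - ξ₂ = ξ₁ := by abel
  simp only [k1, k2]
  exact Λ_cyclic_sum_eq_zero e1 e2 e3

/-- **Tao 2016, (1.2): the cancellation law `⟨B(u,u), u⟩ = 0`** ("as is well known … as can be
seen by a routine integration by parts exploiting the divergence-free nature of `u`"; here via
the Fourier-side symmetrisation Tao points to at the end of p. 3), for every `u ∈ L²(ℝ³; ℂ³)`
that is divergence free on the Fourier side (`ξ · û(ξ) = 0` a.e.). No regularity beyond `L²`
and no realness is needed, because `⟨B(u,u), u⟩ = eulerForm u u u` is *defined* by the Fourier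
formula (1.3) with the Bochner convention. [cite: Tao2016AveragedNS, §1.1 (1.2) p. 3] -/
theorem eulerForm_self_eq_zero {u : L2C} (hu : IsFourierDivFree u) : eulerForm u u u = 0 := by
  rw [eulerForm, integral_Λ_self_eq_zero hu, mul_zero]

/-- **Tao 2016, (1.2) as printed**: `⟨B(u,u), u⟩ = 0` for all `u ∈ H¹⁰_df(ℝ³)`. [cite: Tao2016AveragedNS, §1.1 (1.2) p. 3] -/
theorem eulerForm_self_eq_zero_of_memH10df {u : L2C} (hu : MemH10df u) : eulerForm u u u = 0 :=
  eulerForm_self_eq_zero hu.2.2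

namespace AveragingDatum

/-- **The Euler bilinear operator obeys the cancellation property (1.16)**: for the Euler datum
(`mᵢ ≡ 1`, `Rᵢ = id`, `λᵢ = 1`, so that `B̃ = B`, `euler_form`), `⟨B̃(u,u), u⟩ = ⟨B(u,u), u⟩ = 0`
for all `u ∈ H¹⁰_df(ℝ³)` — (1.16) for this datum is exactly (1.2). (For a general datum (1.16)
"is not automatically satisfied", Tao p. 7; it is a hypothesis of Theorem 1.5.) [cite: Tao2016AveragedNS, §1.1 (1.2), (1.16)] -/
theorem euler_hasCancellation : euler.HasCancellation := by
  intro u hu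
  rw [euler_form]
  exact eulerForm_self_eq_zero hu.2.2

/-- **The Euler bilinear operator is symmetric** as an averaged Euler operator:
`⟨B̃(u,v), w⟩ = ⟨B̃(v,u), w⟩` for the Euler datum (from `eulerForm_symm`, Tao p. 3:
`B(u,v) = -½ P[(u·∇)v + (v·∇)u]`). [cite: Tao2016AveragedNS, §1.1 p. 3] -/
theorem euler_isSymmetric : euler.IsSymmetric := by
  intro u v w _ _ _
  rw [euler_form, euler_form, eulerForm_symm]

/-- **The operator class of Theorem 1.5 is inhabited**: there is a symmetric averaged Euler
bilinear operator obeying the cancellation property (1.16), namely `B` itself (the instance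
`mᵢ ≡ 1`, `Rᵢ = id`, `λᵢ = 1` of (1.13), accepted `euler_form`; cancellation by (1.2)). This is
the non-vacuity of the hypotheses `IsSymmetric ∧ HasCancellation` in `averagedNS_blowup`, not
Theorem 1.5. [cite: Tao2016AveragedNS, §1.1 (1.2), (1.13), Thm. 1.5] -/
theorem exists_isSymmetric_and_hasCancellation :
    ∃ 𝒜 : AveragingDatum, 𝒜.IsSymmetric ∧ 𝒜.HasCancellation :=
  ⟨euler, euler_isSymmetric, euler_hasCancellation⟩

end AveragingDatum

end Literature.Analysis.FluidPDE.Tao2016
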